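import Literature.NumberTheory.Sieve.MaynardNFBilinear
import Literature.NumberTheory.Sieve.BoundedGapsNumberFieldsProofs
import HarnessLib

/-!
# The Maynard–Tao sieve over `𝓞_K`: the residue-class count behind `S₁` (Castillo et al., Lemma 2.2, first half)

Topic `Literature/NumberTheory/Sieve`. The number-field port of the tree's
`Sieve/MaynardSieveCounting.lean` (first half of the proof of Maynard's Lemma 5.1), following
A. Castillo, C. Hall, R. J. Lemke Oliver, P. Pollack, L. Thompson, *Bounded gaps between primes in
number fields and function fields*, Proc. AMS 143 (2015), arXiv:1403.5808, proof of Lemma 2.2: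
"We begin by expanding the square and interchanging the order of summation … the congruence
conditions modulo `𝔴, [𝔡₁,𝔢₁],…,[𝔡_k,𝔢_k]` admit a simultaneous solution; note that in that case
`𝔴, [𝔡₁,𝔢₁], …` are pairwise coprime. Now recall from §2.1 that `|∂A(N,𝔮)| ≪ (|A(N)|/|𝔮|)^{1−ν}`."
Everything in this file is PROVED.

* `regionF K N` (the finset `A(N)`), `S1 K k 𝔴 B y h ν₀ N`, `cnt`; `S1_eq_sum_cnt`, `S1_eq_sum_boxG`
  (expand the square);
* `cnt_eq_zero_of_not_coprime` (incompatible pairs: a maximal ideal above `𝔡ᵢ + 𝔢ⱼ` contains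
  `hᵢ − hⱼ`, hence divides `𝔴`);
* `UniformCount K C` / `exists_uniformCount` — the uniform lattice-point count of §2.1
  (`CastilloEtAl2015.abs_card_box_coset_sub_le_uniform`, totally real `K`) as a hypothesis on `C`;
* `exists_crt_class` (CRT over `𝓞_K`: Mathlib's `Ideal.exists_forall_sub_mem_ideal`,
  `Ideal.prod_eq_iInf_of_pairwise_isCoprime`), **`abs_cnt_sub_le`** — CRT + the count:
  `|cnt − (2^d−1)N^d/(N𝔮√|D_K|)| ≤ C(1 + (N^d/N𝔮)^{1−1/d})`, `N𝔮 = N𝔴 ∏ N[𝔡ᵢ,𝔢ᵢ]`;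
* **`abs_S1_sub_bilinear_le`** — the first display of the printed proof:
  `|S₁ − X ∑' λ_𝔡λ_𝔢/∏N[𝔡ᵢ,𝔢ᵢ]| ≤ |C| ∑_{𝔡,𝔢} |λ_𝔡λ_𝔢| (1 + (N^d/(N𝔴∏N[𝔡ᵢ,𝔢ᵢ]))^{1−1/d})`,
  `X = (2^d−1)N^d/(N𝔴√|D_K|)`;
* Euler-product majorants for the error: `sum_G1_inv_absNorm_le` (`∑_{𝔞∈G1} 1/N𝔞 ≤ C log B`),
  `sum_G1_filter_dvd_le`, `sum_G1_inv_absNorm_inf_le` (`∑_{𝔞,𝔟∈G1} 1/N[𝔞,𝔟] ≤ (∑_{G1} 1/N𝔲)³`,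
  the `τ₃`-bound of the printed proof), `absNorm_inf_le_mul`, `card_boxG_prod_le`,
  `sum_boxG_inv_prod_absNorm_inf_le`, and **`sum_lam_error_le`** — the error sum of Lemma 2.2:
  `∑_{𝔡,𝔢} |λ_𝔡λ_𝔢|(1 + (N^d/(N𝔴∏N[𝔡ᵢ,𝔢ᵢ]))^{1−1/d}) ≤ λ_max²(R²H₁^{2k} + (N^d/N𝔴)^{1−1/d}(R²)^{1/d}H₂^k)`
  for `λ` supported on good tuples of product norm `≤ R` (the paper's
  `λ_max² |A(N)|^{1−ν} R^{2ν} (log R)^{3k}`, `ν = 1/d`);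
* **`abs_S1_sub_main_le`** — **Lemma 2.2 in combinatorial form**:
  `|S₁ − X ∑_𝔲 y_𝔲²/∏φ(𝔲ᵢ)| ≤ X y_max² L^k (Z^{k²−k} − 1) + |C| (y_max L^{2k})² (R²H₁^{2k} + (N^d/N𝔴)^{1−1/d}(R²)^{1/d}H₂^k)`
  (with `MaynardNF.abs_S1main_sub_le` and `abs_lam_le` of `MaynardNFBilinear.lean`);
* bridges `sum_G1_inv_idealTotient_eq`, `sum_G1_inv_gId_eq`, `sum_G1_inv_idealTotient_sq_sub_one_eq`,
  `sum_G1_inv_gId_sq_sub_one_eq` identifying `L, L_g, Z − 1, Z_g − 1` with the one-dimensional sieve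
  sums estimated in `IdealSieveSums.lean`.

## References

* A. Castillo et al., arXiv:1403.5808, §2.1 and proof of Lemma 2.2. [cite: CastilloEtAl2015, §2.2]
* J. Maynard, Ann. of Math. 181 (2015), proof of Lemma 5.1, (5.1). [cite: MaynardAnnals2015, Lemma 5.1]
-/

noncomputable section

open Finset UniqueFactorizationMonoid IsDedekindDomain
open scoped NumberField Classical

namespace Literature.NumberTheory.Sieve.MaynardNF

open UniqueFactorizationMonoid Literature.NumberTheory.LFunctions
  Literature.NumberTheory.LFunctions.NumberField NumberField Module Function
open scoped nonZeroDivisors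

variable {K : Type*} [Field K] [NumberField K]
variable {k : ℕ}

/-! ### The sum `S₁` over `A(N)` and its expansion -/

variable (K) in
/-- The region `A(N) = A₀(2N) ∖ A₀(N)` of Castillo et al. §2.1 as a finset. [cite: CastilloEtAl2015, §2.1] -/
def regionF (N : ℝ) : Finset (𝓞 K) := (CastilloEtAl2015.finite_box (K := K) N).toFinset

/-- Membership in `regionF`. [folklore] -/
theorem mem_regionF {N : ℝ} {α : 𝓞 K} : α ∈ regionF K N ↔ α ∈ CastilloEtAl2015.box K N := by
  rw [regionF, Set.Finite.mem_toFinset]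

variable (K) in
/-- The sum `S₁` of Castillo et al. §2.2 (Maynard's `S₁` over `𝓞_K`) for the weights `λ = lam B y`:
`S₁ = ∑_{α ∈ A(N), α ≡ ν₀ (𝔴)} (∑_{𝔡ᵢ ∣ (α + hᵢ) ∀ i} λ_𝔡)²`, the `𝔡ᵢ` running over the box.
[cite: CastilloEtAl2015, §2.2 (definition of S₁)] -/
def S1 (k : ℕ) (𝔴 : Ideal (𝓞 K)) (B : ℝ) (y : (Fin k → Ideal (𝓞 K)) → ℝ) (h : Fin k → 𝓞 K)
    (ν₀ : 𝓞 K) (N : ℝ) : ℝ :=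
  ∑ α ∈ (regionF K N).filter (fun α => α - ν₀ ∈ 𝔴),
    (∑ 𝔡 ∈ (box K k B).filter (fun 𝔡 => ∀ i, α + h i ∈ 𝔡 i), lam K k B y 𝔡) ^ 2

variable (K) in
/-- The inner count after expanding the square:
`#{α ∈ A(N) : α ≡ ν₀ (𝔴), α + hᵢ ∈ 𝔡ᵢ ∩ 𝔢ᵢ ∀ i}`. [cite: CastilloEtAl2015, §2.2] -/
def cnt (𝔴 : Ideal (𝓞 K)) (h : Fin k → 𝓞 K) (ν₀ : 𝓞 K) (N : ℝ) (𝔡 𝔢 : Fin k → Ideal (𝓞 K)) : ℕ :=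
  ((regionF K N).filter fun α => α - ν₀ ∈ 𝔴 ∧ ∀ i, α + h i ∈ 𝔡 i ∧ α + h i ∈ 𝔢 i).card

/-- **Expanding the square**: `S₁ = ∑_{𝔡, 𝔢} λ_𝔡 λ_𝔢 #{α : α ≡ ν₀ (𝔴), α + hᵢ ∈ 𝔡ᵢ ∩ 𝔢ᵢ ∀ i}`.
[cite: CastilloEtAl2015, §2.2] -/
theorem S1_eq_sum_cnt (𝔴 : Ideal (𝓞 K)) (B : ℝ) (y : (Fin k → Ideal (𝓞 K)) → ℝ) (h : Fin k → 𝓞 K)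
    (ν₀ : 𝓞 K) (N : ℝ) :
    S1 K k 𝔴 B y h ν₀ N =
      ∑ 𝔡 ∈ box K k B, ∑ 𝔢 ∈ box K k B,
        lam K k B y 𝔡 * lam K k B y 𝔢 * (cnt K 𝔴 h ν₀ N 𝔡 𝔢 : ℝ) := by
  classical
  unfold S1
  have hsq : ∀ α : 𝓞 K,
      (∑ 𝔡 ∈ (box K k B).filter (fun 𝔡 => ∀ i, α + h i ∈ 𝔡 i), lam K k B y 𝔡) ^ 2 =
        ∑ 𝔡 ∈ box K k B, ∑ 𝔢 ∈ box K k B,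
          if (∀ i, α + h i ∈ 𝔡 i ∧ α + h i ∈ 𝔢 i) then lam K k B y 𝔡 * lam K k B y 𝔢 else 0 := by
    intro α
    rw [sq, Finset.sum_filter, Finset.sum_mul_sum]
    refine Finset.sum_congr rfl fun 𝔡 _ => Finset.sum_congr rfl fun 𝔢 _ => ?_
    by_cases hd : ∀ i, α + h i ∈ 𝔡 i <;> by_cases he : ∀ i, α + h i ∈ 𝔢 i <;>
      simp [hd, he, forall_and]
  simp_rw [hsq]
  rw [Finset.sum_comm]
  refine Finset.sum_congr rfl fun 𝔡 _ => ?_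
  rw [Finset.sum_comm]
  refine Finset.sum_congr rfl fun 𝔢 _ => ?_
  rw [← Finset.sum_filter, Finset.filter_filter, Finset.sum_const, nsmul_eq_mul, mul_comm]
  rfl

/-- Only good tuples contribute (`λ_𝔡 = 0` off `boxG`). [cite: CastilloEtAl2015, §2.2] -/
theorem S1_eq_sum_boxG {𝔴 : Ideal (𝓞 K)} {B : ℝ} {y : (Fin k → Ideal (𝓞 K)) → ℝ}
    (hy : SupportedOn K k 𝔴 B y) (h : Fin k → 𝓞 K) (ν₀ : 𝓞 K) (N : ℝ) :
    S1 K k 𝔴 B y h ν₀ N =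
      ∑ 𝔡 ∈ boxG K k 𝔴 B, ∑ 𝔢 ∈ boxG K k 𝔴 B,
        lam K k B y 𝔡 * lam K k B y 𝔢 * (cnt K 𝔴 h ν₀ N 𝔡 𝔢 : ℝ) := by
  rw [S1_eq_sum_cnt]
  have hsub : boxG K k 𝔴 B ⊆ box K k B := Finset.filter_subset _ _
  symm
  rw [Finset.sum_subset hsub fun 𝔡 _ hd => ?_]
  · refine Finset.sum_congr rfl fun 𝔡 _ => Finset.sum_subset hsub fun 𝔢 _ he => ?_
    rw [lam_eq_zero_of_not hy he, mul_zero, zero_mul]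
  · exact Finset.sum_eq_zero fun 𝔢 _ => by rw [lam_eq_zero_of_not hy hd, zero_mul, zero_mul]

/-- **Incompatible pairs count nothing**: if some `𝔡ᵢ`, `𝔢ⱼ` (`i ≠ j`) are not comaximal, no `α` has
`α + hᵢ ∈ 𝔡ᵢ` and `α + hⱼ ∈ 𝔢ⱼ` — a maximal ideal above `𝔡ᵢ + 𝔢ⱼ` contains `hᵢ − hⱼ`, hence
(hypothesis `hh`) divides `𝔴`, contradicting `𝔡ᵢ + 𝔴 = (1)`. [cite: CastilloEtAl2015, §2.2] -/
theorem cnt_eq_zero_of_not_coprime {𝔴 : Ideal (𝓞 K)} {h : Fin k → 𝓞 K}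
    (hh : ∀ i j, i ≠ j → ∀ P : Ideal (𝓞 K), P.IsPrime → h i - h j ∈ P → P ∣ 𝔴) (ν₀ : 𝓞 K) (N : ℝ)
    {𝔡 𝔢 : Fin k → Ideal (𝓞 K)} (hd : IsGood 𝔴 𝔡) {p : OffDiag k}
    (hp : ¬ 𝔡 p.1.1 ⊔ 𝔢 p.1.2 = ⊤) : cnt K 𝔴 h ν₀ N 𝔡 𝔢 = 0 := by
  rw [cnt, Finset.card_eq_zero, Finset.filter_eq_empty_iff]
  rintro α - ⟨-, hα⟩
  obtain ⟨⟨i, j⟩, hij⟩ := p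
  simp only at hp hij
  obtain ⟨M, hM, hle⟩ := Ideal.exists_le_maximal _ hp
  have h1 : α + h i ∈ M := hle (Ideal.mem_sup_left (hα i).1)
  have h2 : α + h j ∈ M := hle (Ideal.mem_sup_right (hα j).2)
  have h3 : h i - h j ∈ M := by
    have := M.sub_mem h1 h2
    rwa [add_sub_add_left_eq_sub] at this
  have hMw : M ∣ 𝔴 := hh i j hij M hM.isPrime h3
  have : 𝔡 i ⊔ 𝔴 ≤ M := sup_le (le_sup_left.trans hle) (Ideal.le_of_dvd hMw)
  rw [hd.sup_eq_top_apply i, top_le_iff] at this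
  exact hM.ne_top this

/-- The uniform residue-class count of `BoundedGapsNumberFieldsProofs` (`abs_card_box_coset_sub_le_uniform`)
as a hypothesis on a constant `C`. [cite: CastilloEtAl2015, §2.1] -/
def UniformCount (K : Type*) [Field K] [NumberField K] (C : ℝ) : Prop :=
  ∀ (𝔮 : (Ideal (𝓞 K))⁰) (N : ℝ), 1 ≤ N → ∀ α₀ : 𝓞 K,
    |(Nat.card {α : 𝓞 K // α ∈ CastilloEtAl2015.box K N ∧ α - α₀ ∈ (𝔮 : Ideal (𝓞 K))} : ℝ) -
        (2 ^ finrank ℚ K - 1) * N ^ finrank ℚ K /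
          (Ideal.absNorm (𝔮 : Ideal (𝓞 K)) * √|discr K|)| ≤
      C * (1 + (N ^ finrank ℚ K / Ideal.absNorm (𝔮 : Ideal (𝓞 K))) ^ (1 - 1 / (finrank ℚ K : ℝ)))

/-- The uniform count holds for totally real `K`. [cite: CastilloEtAl2015, §2.1] -/
theorem exists_uniformCount [IsTotallyReal K] : ∃ C : ℝ, UniformCount K C :=
  CastilloEtAl2015.abs_card_box_coset_sub_le_uniform K

/-- **The Chinese remainder theorem step** (proof of Lemma 2.2: "the congruence conditions modulo
`𝔴, [𝔡₁,𝔢₁], …, [𝔡_k,𝔢_k]` admit a simultaneous solution; note that in that case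
`𝔴, [𝔡₁,𝔢₁], …` are pairwise coprime"): for good `𝔡, 𝔢` with `(𝔡ᵢ, 𝔢ⱼ) = 1` (`i ≠ j`) the
conditions `α ≡ ν₀ (𝔴)`, `α + hᵢ ∈ 𝔡ᵢ ∩ 𝔢ᵢ` cut out one residue class `a` modulo
`𝔮 = 𝔴 ∏ᵢ [𝔡ᵢ, 𝔢ᵢ]` (Mathlib's `Ideal.exists_forall_sub_mem_ideal`,
`Ideal.prod_eq_iInf_of_pairwise_isCoprime`), `𝔮 ≠ 0`, `N𝔮 = N𝔴 ∏ N[𝔡ᵢ,𝔢ᵢ]`, and the moduli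
`[𝔡ᵢ, 𝔢ᵢ]` are comaximal with `𝔴` and pairwise comaximal. [cite: CastilloEtAl2015, §2.2, proof of Lemma 2.2] -/
theorem exists_crt_class {𝔴 : Ideal (𝓞 K)} (h𝔴 : 𝔴 ≠ ⊥)
    {𝔡 𝔢 : Fin k → Ideal (𝓞 K)} (hd : IsGood 𝔴 𝔡) (he : IsGood 𝔴 𝔢)
    (hc : ∀ p : OffDiag k, 𝔡 p.1.1 ⊔ 𝔢 p.1.2 = ⊤) (h : Fin k → 𝓞 K) (ν₀ : 𝓞 K) :
    ∃ a : 𝓞 K,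
      (∀ α : 𝓞 K, (α - ν₀ ∈ 𝔴 ∧ ∀ i, α + h i ∈ 𝔡 i ∧ α + h i ∈ 𝔢 i) ↔
        α - a ∈ 𝔴 * ∏ i, (𝔡 i ⊓ 𝔢 i)) ∧
      𝔴 * ∏ i, (𝔡 i ⊓ 𝔢 i) ≠ ⊥ ∧
      ((Ideal.absNorm (𝔴 * ∏ i, (𝔡 i ⊓ 𝔢 i)) : ℝ) =
        Ideal.absNorm 𝔴 * ∏ i, (Ideal.absNorm (𝔡 i ⊓ 𝔢 i) : ℝ)) ∧
      (∀ i, (𝔡 i ⊓ 𝔢 i) ⊔ 𝔴 = ⊤) ∧ (∀ i j, i ≠ j → (𝔡 i ⊓ 𝔢 i) ⊔ (𝔡 j ⊓ 𝔢 j) = ⊤) := by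
  classical
  -- the moduli `Lᵢ = [𝔡ᵢ, 𝔢ᵢ]`: comaximal with `𝔴`, pairwise comaximal
  set L : Fin k → Ideal (𝓞 K) := fun i => 𝔡 i ⊓ 𝔢 i with hL
  have hLW : ∀ i, L i ⊔ 𝔴 = ⊤ := fun i => by
    have : 𝔡 i * 𝔢 i ⊔ 𝔴 = ⊤ := mul_sup_eq_top_iff.2 ⟨hd.sup_eq_top_apply i, he.sup_eq_top_apply i⟩
    rw [eq_top_iff, ← this]
    exact sup_le_sup_right Ideal.mul_le_inf _
  have hLL : ∀ i j, i ≠ j → L i ⊔ L j = ⊤ := fun i j hij => by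
    have hdd := hd.sup_eq_top_of_ne hij
    have hee := he.sup_eq_top_of_ne hij
    have hde : 𝔡 i ⊔ 𝔢 j = ⊤ := hc ⟨(i, j), hij⟩
    have hed : 𝔢 i ⊔ 𝔡 j = ⊤ := by rw [sup_comm]; exact hc ⟨(j, i), hij.symm⟩
    have h1 : 𝔡 i * 𝔢 i ⊔ (𝔡 j * 𝔢 j) = ⊤ := by
      rw [mul_sup_eq_top_iff]
      constructor
      · rw [sup_comm, mul_sup_eq_top_iff, sup_comm, sup_comm (a := 𝔢 j)]; exact ⟨hdd, hde⟩
      · rw [sup_comm, mul_sup_eq_top_iff, sup_comm, sup_comm (a := 𝔢 j)]; exact ⟨hed, hee⟩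
    rw [eq_top_iff, ← h1]
    exact sup_le_sup Ideal.mul_le_inf Ideal.mul_le_inf
  -- the CRT family on `Option (Fin k)`: `none ↦ 𝔴`, `some i ↦ Lᵢ`
  set f : Option (Fin k) → Ideal (𝓞 K) := fun o => o.elim 𝔴 L with hf
  have hpair : Pairwise (IsCoprime on f) := by
    intro o o' hne
    rw [Function.onFun, Ideal.isCoprime_iff_sup_eq]
    cases o with
    | none =>
      cases o' with
      | none => exact absurd rfl hne
      | some j => simp only [hf, Option.elim]; rw [sup_comm]; exact hLW j
    | some i =>
      cases o' with
      | none => simp only [hf, Option.elim]; exact hLW i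
      | some j =>
        simp only [hf, Option.elim]
        exact hLL i j fun hij => hne (by rw [hij])
  set x : Option (Fin k) → 𝓞 K := fun o => o.elim ν₀ (fun i => -h i) with hx
  obtain ⟨a, ha⟩ := Ideal.exists_forall_sub_mem_ideal hpair x
  set 𝔮 : Ideal (𝓞 K) := ⨅ o, f o with hq
  -- the filter condition is one residue class modulo `𝔮`
  have hiff : ∀ α : 𝓞 K, (α - ν₀ ∈ 𝔴 ∧ ∀ i, α + h i ∈ 𝔡 i ∧ α + h i ∈ 𝔢 i) ↔ α - a ∈ 𝔮 := by
    intro α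
    have key : ∀ o, (α - x o ∈ f o ↔ α - a ∈ f o) := by
      intro o
      have : α - x o = (α - a) + (a - x o) := by ring
      rw [this]
      exact ⟨fun hmem => by simpa using (f o).sub_mem hmem (ha o), fun hmem => (f o).add_mem hmem (ha o)⟩
    rw [hq, Ideal.mem_iInf]
    constructor
    · rintro ⟨h0, hi⟩ o
      rw [← key]
      cases o with
      | none => simpa [hx, hf] using h0
      | some i =>
        simp only [hx, hf, Option.elim, sub_neg_eq_add, hL]
        exact ⟨(hi i).1, (hi i).2⟩
    · intro hall
      refine ⟨?_, fun i => ?_⟩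
      · have := (key none).2 (hall none)
        simpa [hx, hf] using this
      · have := (key (some i)).2 (hall (some i))
        simp only [hx, hf, Option.elim, sub_neg_eq_add, hL] at this
        exact ⟨this.1, this.2⟩
  -- `𝔮 = 𝔴 ∏ Lᵢ` and its norm
  have hqprod : 𝔮 = 𝔴 * ∏ i, L i := by
    have h1 : ∏ o ∈ (Finset.univ : Finset (Option (Fin k))), f o = ⨅ o ∈ (Finset.univ : Finset (Option (Fin k))), f o :=
      Ideal.prod_eq_iInf_of_pairwise_isCoprime fun o _ o' _ hne => hpair hne
    rw [hq, show (⨅ o, f o) = ⨅ o ∈ (Finset.univ : Finset (Option (Fin k))), f o by simp, ← h1,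
      Fintype.prod_option]
    rfl
  have hq0 : 𝔮 ≠ ⊥ := by
    rw [hqprod]
    refine mul_ne_zero h𝔴 (Finset.prod_ne_zero_iff.2 fun i _ => ?_)
    intro h0
    have : L i ≤ ⊥ := le_of_eq h0
    have hdi : 𝔡 i * 𝔢 i ≤ ⊥ := Ideal.mul_le_inf.trans this
    rw [le_bot_iff, ← Ideal.zero_eq_bot, mul_eq_zero] at hdi
    rcases hdi with h | h
    · exact hd.ne_bot i (by rwa [Ideal.zero_eq_bot] at h)
    · exact he.ne_bot i (by rwa [Ideal.zero_eq_bot] at h)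
  have hqnorm : (Ideal.absNorm 𝔮 : ℝ) = Ideal.absNorm 𝔴 * ∏ i, (Ideal.absNorm (𝔡 i ⊓ 𝔢 i) : ℝ) := by
    rw [hqprod, map_mul, map_prod]
    push_cast
    rfl
  refine ⟨a, fun α => ?_, ?_, ?_, hLW, hLL⟩
  · rw [hiff α, hqprod]
  · rw [← hqprod]; exact hq0
  · rw [← hqprod]; exact hqnorm

/-- **The count in one residue class** (CRT over `𝓞_K` + the lattice-point count of §2.1): for good
`𝔡, 𝔢` with `(𝔡ᵢ, 𝔢ⱼ) = 1` (`i ≠ j`), `𝔴 ≠ 0` and `N ≥ 1`, with `𝔮 = 𝔴 ∏ᵢ [𝔡ᵢ, 𝔢ᵢ]`,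
`|cnt − (2^d − 1)N^d/(N𝔮 √|D_K|)| ≤ C (1 + (N^d/N𝔮)^{1−1/d})`, `N𝔮 = N𝔴 ∏ N[𝔡ᵢ,𝔢ᵢ]`.
[cite: CastilloEtAl2015, §2.1–§2.2] -/
theorem abs_cnt_sub_le {C : ℝ} (hC : UniformCount K C) {𝔴 : Ideal (𝓞 K)} (h𝔴 : 𝔴 ≠ ⊥)
    {𝔡 𝔢 : Fin k → Ideal (𝓞 K)} (hd : IsGood 𝔴 𝔡) (he : IsGood 𝔴 𝔢)
    (hc : ∀ p : OffDiag k, 𝔡 p.1.1 ⊔ 𝔢 p.1.2 = ⊤) (h : Fin k → 𝓞 K) (ν₀ : 𝓞 K) {N : ℝ}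
    (hN : 1 ≤ N) :
    |(cnt K 𝔴 h ν₀ N 𝔡 𝔢 : ℝ) -
        (2 ^ finrank ℚ K - 1) * N ^ finrank ℚ K /
          ((Ideal.absNorm 𝔴 * ∏ i, (Ideal.absNorm (𝔡 i ⊓ 𝔢 i) : ℝ)) * √|discr K|)| ≤
      C * (1 + (N ^ finrank ℚ K / (Ideal.absNorm 𝔴 * ∏ i, (Ideal.absNorm (𝔡 i ⊓ 𝔢 i) : ℝ))) ^
        (1 - 1 / (finrank ℚ K : ℝ))) := by
  classical
  obtain ⟨a, hiff, hq0, hqnorm, -, -⟩ := exists_crt_class h𝔴 hd he hc h ν₀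
  set 𝔮 : Ideal (𝓞 K) := 𝔴 * ∏ i, (𝔡 i ⊓ 𝔢 i) with hq
  have hcard : (cnt K 𝔴 h ν₀ N 𝔡 𝔢 : ℝ) =
      Nat.card {α : 𝓞 K // α ∈ CastilloEtAl2015.box K N ∧ α - a ∈ 𝔮} := by
    rw [cnt, ← Nat.card_eq_finsetCard]
    congr 1
    exact Nat.card_congr (Equiv.subtypeEquivRight fun α => by
      rw [Finset.mem_filter, mem_regionF, hiff])
  have hmain := hC ⟨𝔮, mem_nonZeroDivisors_of_ne_zero (by rwa [Ne, Ideal.zero_eq_bot])⟩ N hN a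
  simp only at hmain
  rw [hcard, ← hqnorm]
  exact hmain

/-- **Display (5.1) over `𝓞_K`** (first display of the proof of Lemma 2.2 of Castillo et al.): with
`X = (2^d − 1)N^d/(N𝔴 √|D_K|)` (`= |A(N)|/|𝔴|` up to the lattice-point error),
`|S₁ − X ∑'_{𝔡,𝔢} λ_𝔡λ_𝔢/∏ N[𝔡ᵢ,𝔢ᵢ]| ≤ |C| ∑_{𝔡,𝔢 good} |λ_𝔡λ_𝔢| (1 + (N^d/(N𝔴 ∏ N[𝔡ᵢ,𝔢ᵢ]))^{1−1/d})`
(the restriction `∑'` to `(𝔡ᵢ, 𝔢ⱼ) = 1`, `i ≠ j`; the right side is the paper's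
`λ_max² ∑' |∂A(N, 𝔴∏[𝔡ᵢ,𝔢ᵢ])|` with `|∂A(N,𝔮)| ≪ (|A(N)|/|𝔮|)^{1−ν}`, `ν = 1/d`). Hypothesis `hh`:
every prime ideal containing some `hᵢ − hⱼ` (`i ≠ j`) divides `𝔴`. [cite: CastilloEtAl2015, §2.2, proof of Lemma 2.2] -/
theorem abs_S1_sub_bilinear_le {C : ℝ} (hC : UniformCount K C) {𝔴 : Ideal (𝓞 K)} (h𝔴 : 𝔴 ≠ ⊥)
    {B : ℝ} {y : (Fin k → Ideal (𝓞 K)) → ℝ} (hy : SupportedOn K k 𝔴 B y) {h : Fin k → 𝓞 K}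
    (hh : ∀ i j, i ≠ j → ∀ P : Ideal (𝓞 K), P.IsPrime → h i - h j ∈ P → P ∣ 𝔴) (ν₀ : 𝓞 K)
    {N : ℝ} (hN : 1 ≤ N) :
    |S1 K k 𝔴 B y h ν₀ N -
        (2 ^ finrank ℚ K - 1) * N ^ finrank ℚ K / (Ideal.absNorm 𝔴 * √|discr K|) *
          ∑ 𝔡 ∈ boxG K k 𝔴 B, ∑ 𝔢 ∈ boxG K k 𝔴 B,
            (if ∀ p : OffDiag k, 𝔡 p.1.1 ⊔ 𝔢 p.1.2 = ⊤ then
              lam K k B y 𝔡 * lam K k B y 𝔢 / ∏ i, (Ideal.absNorm (𝔡 i ⊓ 𝔢 i) : ℝ) else 0)| ≤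
      |C| * ∑ 𝔡 ∈ boxG K k 𝔴 B, ∑ 𝔢 ∈ boxG K k 𝔴 B,
        |lam K k B y 𝔡| * |lam K k B y 𝔢| *
          (1 + (N ^ finrank ℚ K / (Ideal.absNorm 𝔴 * ∏ i, (Ideal.absNorm (𝔡 i ⊓ 𝔢 i) : ℝ))) ^
            (1 - 1 / (finrank ℚ K : ℝ))) := by
  set d := finrank ℚ K with hdK
  set X : ℝ := (2 ^ d - 1) * N ^ d / (Ideal.absNorm 𝔴 * √|discr K|) with hX
  have hN0 : 0 ≤ N := by linarith
  have hN𝔴 : (1 : ℝ) ≤ Ideal.absNorm 𝔴 := by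
    exact_mod_cast Nat.one_le_iff_ne_zero.2 (by rwa [Ne, Ideal.absNorm_eq_zero_iff])
  -- the termwise estimate
  have hterm : ∀ 𝔡 ∈ boxG K k 𝔴 B, ∀ 𝔢 ∈ boxG K k 𝔴 B,
      |lam K k B y 𝔡 * lam K k B y 𝔢 * (cnt K 𝔴 h ν₀ N 𝔡 𝔢 : ℝ) -
          X * (if ∀ p : OffDiag k, 𝔡 p.1.1 ⊔ 𝔢 p.1.2 = ⊤ then
            lam K k B y 𝔡 * lam K k B y 𝔢 / ∏ i, (Ideal.absNorm (𝔡 i ⊓ 𝔢 i) : ℝ) else 0)| ≤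
        |C| * (|lam K k B y 𝔡| * |lam K k B y 𝔢| *
          (1 + (N ^ d / (Ideal.absNorm 𝔴 * ∏ i, (Ideal.absNorm (𝔡 i ⊓ 𝔢 i) : ℝ))) ^
            (1 - 1 / (d : ℝ)))) := by
    intro 𝔡 hd 𝔢 he
    have hdG := (mem_boxG.1 hd).2
    have heG := (mem_boxG.1 he).2
    set P : ℝ := ∏ i, (Ideal.absNorm (𝔡 i ⊓ 𝔢 i) : ℝ) with hP
    have hLi : ∀ i, (1 : ℝ) ≤ Ideal.absNorm (𝔡 i ⊓ 𝔢 i) := by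
      intro i
      have h0 : 𝔡 i ⊓ 𝔢 i ≠ ⊥ := by
        intro h0
        have hdi : 𝔡 i * 𝔢 i ≤ ⊥ := Ideal.mul_le_inf.trans (le_of_eq h0)
        rw [le_bot_iff, ← Ideal.zero_eq_bot, mul_eq_zero] at hdi
        rcases hdi with h | h
        · exact hdG.ne_bot i (by rwa [Ideal.zero_eq_bot] at h)
        · exact heG.ne_bot i (by rwa [Ideal.zero_eq_bot] at h)
      exact_mod_cast Nat.one_le_iff_ne_zero.2 (by rwa [Ne, Ideal.absNorm_eq_zero_iff])
    have hP1 : 1 ≤ P := by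
      rw [hP, ← Finset.prod_const_one (s := (Finset.univ : Finset (Fin k)))]
      exact Finset.prod_le_prod (fun _ _ => zero_le_one) fun i _ => hLi i
    have hP0 : 0 < P := by linarith
    have ha0 : (0 : ℝ) < Ideal.absNorm 𝔴 := by linarith
    have hbase : 0 ≤ N ^ d / (Ideal.absNorm 𝔴 * P) := div_nonneg (pow_nonneg hN0 d) (mul_pos ha0 hP0).le
    have hr0 : 0 ≤ (N ^ d / (Ideal.absNorm 𝔴 * P)) ^ (1 - 1 / (d : ℝ)) := Real.rpow_nonneg hbase _
    have hfac0 : 0 ≤ 1 + (N ^ d / (Ideal.absNorm 𝔴 * P)) ^ (1 - 1 / (d : ℝ)) := by linarith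
    by_cases hc : ∀ p : OffDiag k, 𝔡 p.1.1 ⊔ 𝔢 p.1.2 = ⊤
    · rw [if_pos hc]
      have h1 := abs_cnt_sub_le hC h𝔴 hdG heG hc h ν₀ hN
      have hXP : X / P = (2 ^ d - 1) * N ^ d / ((Ideal.absNorm 𝔴 * P) * √|discr K|) := by
        rw [hX, div_div]
        ring_nf
      have halg : lam K k B y 𝔡 * lam K k B y 𝔢 * (cnt K 𝔴 h ν₀ N 𝔡 𝔢 : ℝ) -
          X * (lam K k B y 𝔡 * lam K k B y 𝔢 / P) =
          (lam K k B y 𝔡 * lam K k B y 𝔢) * ((cnt K 𝔴 h ν₀ N 𝔡 𝔢 : ℝ) - X / P) := by ring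
      rw [halg, abs_mul, abs_mul, hXP]
      calc |lam K k B y 𝔡| * |lam K k B y 𝔢| *
            |(cnt K 𝔴 h ν₀ N 𝔡 𝔢 : ℝ) - (2 ^ d - 1) * N ^ d / ((Ideal.absNorm 𝔴 * P) * √|discr K|)|
          ≤ |lam K k B y 𝔡| * |lam K k B y 𝔢| *
              (C * (1 + (N ^ d / (Ideal.absNorm 𝔴 * P)) ^ (1 - 1 / (d : ℝ)))) :=
            mul_le_mul_of_nonneg_left h1 (mul_nonneg (abs_nonneg _) (abs_nonneg _))
        _ ≤ |lam K k B y 𝔡| * |lam K k B y 𝔢| *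
              (|C| * (1 + (N ^ d / (Ideal.absNorm 𝔴 * P)) ^ (1 - 1 / (d : ℝ)))) :=
            mul_le_mul_of_nonneg_left (mul_le_mul_of_nonneg_right (le_abs_self C) hfac0)
              (mul_nonneg (abs_nonneg _) (abs_nonneg _))
        _ = _ := by ring
    · rw [if_neg hc]
      push Not at hc
      obtain ⟨p, hp⟩ := hc
      rw [cnt_eq_zero_of_not_coprime hh ν₀ N hdG hp]
      simp only [Nat.cast_zero, mul_zero, sub_zero, abs_zero]
      exact mul_nonneg (abs_nonneg C) (mul_nonneg (mul_nonneg (abs_nonneg _) (abs_nonneg _)) hfac0)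
  have hL : S1 K k 𝔴 B y h ν₀ N - X * ∑ 𝔡 ∈ boxG K k 𝔴 B, ∑ 𝔢 ∈ boxG K k 𝔴 B,
      (if ∀ p : OffDiag k, 𝔡 p.1.1 ⊔ 𝔢 p.1.2 = ⊤ then
        lam K k B y 𝔡 * lam K k B y 𝔢 / ∏ i, (Ideal.absNorm (𝔡 i ⊓ 𝔢 i) : ℝ) else 0) =
      ∑ 𝔡 ∈ boxG K k 𝔴 B, ∑ 𝔢 ∈ boxG K k 𝔴 B,
        (lam K k B y 𝔡 * lam K k B y 𝔢 * (cnt K 𝔴 h ν₀ N 𝔡 𝔢 : ℝ) -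
          X * (if ∀ p : OffDiag k, 𝔡 p.1.1 ⊔ 𝔢 p.1.2 = ⊤ then
            lam K k B y 𝔡 * lam K k B y 𝔢 / ∏ i, (Ideal.absNorm (𝔡 i ⊓ 𝔢 i) : ℝ) else 0)) := by
    rw [S1_eq_sum_boxG hy, Finset.mul_sum, ← Finset.sum_sub_distrib]
    refine Finset.sum_congr rfl fun 𝔡 _ => ?_
    rw [Finset.mul_sum, ← Finset.sum_sub_distrib]
  rw [hL, Finset.mul_sum]
  refine (Finset.abs_sum_le_sum_abs _ _).trans (Finset.sum_le_sum fun 𝔡 hd => ?_)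
  rw [Finset.mul_sum]
  exact (Finset.abs_sum_le_sum_abs _ _).trans (Finset.sum_le_sum fun 𝔢 he => hterm 𝔡 hd 𝔢 he)

end Literature.NumberTheory.Sieve.MaynardNF

namespace Literature.NumberTheory.Sieve.MaynardNF

open UniqueFactorizationMonoid Literature.NumberTheory.LFunctions
  Literature.NumberTheory.LFunctions.NumberField NumberField IsDedekindDomain
  Literature.NumberTheory.Sieve.SquarefreeIdeal

variable {K : Type*} [Field K] [NumberField K]

/-! ### Euler-product majorants for the error terms of Lemma 2.2 -/

/-- `N(∏_{𝔭∈S} 𝔭) = ∏_{𝔭∈S} N𝔭` (real). [folklore] -/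
theorem absNorm_prodIdeal_real (S : Finset (HeightOneSpectrum (𝓞 K))) :
    (Ideal.absNorm (prodIdeal S) : ℝ) = ∏ v ∈ S, (Ideal.absNorm v.asIdeal : ℝ) := by
  rw [prodIdeal, map_prod]; push_cast; rfl

variable (K) in
/-- **The harmonic sum over the good scalars**: `∑_{𝔞 ∈ G1} 1/N𝔞 ≤ C log B` for `B ≥ 2`
(square-free sums are bounded by the Euler product `∏_{N𝔭 ≤ B}(1 + 1/N𝔭) ≪ log B`).
[cite: CastilloEtAl2015, proof of Lemma 2.2 (estimation of sums by Euler products)] -/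
theorem sum_G1_inv_absNorm_le :
    ∃ C : ℝ, ∀ (𝔴 : Ideal (𝓞 K)) (B : ℝ), 2 ≤ B →
      ∑ 𝔞 ∈ G1 K 𝔴 B, 1 / (Ideal.absNorm 𝔞 : ℝ) ≤ C * Real.log B := by
  obtain ⟨C, hC⟩ := prod_one_add_div_absNorm_le K zero_le_one
  refine ⟨C, fun 𝔴 B hB => ?_⟩
  set T : Finset (Ideal (𝓞 K)) := (finite_primeIdealsLE K B).toFinset with hT
  have hfin : (HeightOneSpectrum.asIdeal ⁻¹' (↑T : Set (Ideal (𝓞 K)))).Finite :=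
    Set.Finite.preimage (fun v _ w _ h => HeightOneSpectrum.ext h) T.finite_toSet
  set P : Finset (HeightOneSpectrum (𝓞 K)) := hfin.toFinset with hP
  have hmemP : ∀ v, v ∈ P ↔ v.asIdeal ∈ T := by
    intro v; rw [hP, Set.Finite.mem_toFinset, Set.mem_preimage, Finset.mem_coe]
  have h1 := sum_le_prod_one_add P (h := fun v => 1 / (Ideal.absNorm v.asIdeal : ℝ))
    (fun v _ => by positivity) (g := fun I => 1 / (Ideal.absNorm I : ℝ))
    (fun S _ => by
      rw [absNorm_prodIdeal_real, one_div, ← Finset.prod_inv_distrib]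
      exact Finset.prod_congr rfl fun v _ => (one_div _).symm)
    (G1 K 𝔴 B) (fun I hI => by
      obtain ⟨⟨hI0, hIB⟩, hsq, -⟩ := mem_G1.1 hI
      obtain ⟨S, hS, rfl⟩ := exists_eq_prodIdeal_subset_of_absNorm_le K
        (by rwa [Ne, Ideal.zero_eq_bot]) hsq hIB
      exact ⟨S, fun v hv => (hmemP v).2 (hS v hv), rfl⟩)
  refine h1.trans ?_
  -- `∏_{v ∈ P} (1 + 1/Nv) = ∏_{I ∈ T} (1 + 1/N I) ≤ C log B`
  have himage : P.image HeightOneSpectrum.asIdeal = T := by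
    ext I
    rw [Finset.mem_image]
    constructor
    · rintro ⟨v, hv, rfl⟩; exact (hmemP v).1 hv
    · intro hI
      have hI' := hI
      rw [hT, Set.Finite.mem_toFinset] at hI'
      exact ⟨⟨I, hI'.1, hI'.2.1⟩, (hmemP _).2 hI, rfl⟩
  rw [← Finset.prod_image (s := P) (g := HeightOneSpectrum.asIdeal)
    (f := fun I => 1 + 1 / (Ideal.absNorm I : ℝ)) (fun v _ w _ h => HeightOneSpectrum.ext h), himage]
  have := hC B hB
  rwa [Real.rpow_one] at this

/-- `φ(𝔲) ≤ N𝔲`. [folklore] -/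
theorem idealTotient_le_absNorm (𝔲 : Ideal (𝓞 K)) : idealTotient K 𝔲 ≤ (Ideal.absNorm 𝔲 : ℝ) := by
  rw [idealTotient]
  refine mul_le_of_le_one_right (Nat.cast_nonneg _) (Finset.prod_le_one (fun P hP => ?_) fun P hP => ?_)
  · have h2 : (2 : ℝ) ≤ Ideal.absNorm P := by
      exact_mod_cast two_le_absNorm_of_prime (prime_of_normalized_factor P (Multiset.mem_toFinset.1 hP))
    have : 1 / (Ideal.absNorm P : ℝ) ≤ 1 / 2 := by rw [div_le_div_iff₀ (by linarith) two_pos]; linarith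
    linarith
  · have : 0 ≤ 1 / (Ideal.absNorm P : ℝ) := by positivity
    linarith

/-- The harmonic sum over the multiples of `𝔲` in `G1`: `∑_{𝔞 ∈ G1, 𝔲 ∣ 𝔞} 1/N𝔞 ≤ (1/N𝔲) ∑_{𝔞' ∈ G1} 1/N𝔞'`
(`𝔞 = 𝔲 𝔞'`, `N𝔞 = N𝔲 N𝔞'`, `𝔞' ∈ G1`). [folklore] -/
theorem sum_G1_filter_dvd_le {𝔴 : Ideal (𝓞 K)} {B : ℝ} {𝔲 : Ideal (𝓞 K)} (hu : 𝔲 ≠ ⊥) :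
    ∑ 𝔞 ∈ (G1 K 𝔴 B).filter (fun 𝔞 => 𝔲 ∣ 𝔞), 1 / (Ideal.absNorm 𝔞 : ℝ) ≤
      1 / (Ideal.absNorm 𝔲 : ℝ) * ∑ 𝔞 ∈ G1 K 𝔴 B, 1 / (Ideal.absNorm 𝔞 : ℝ) := by
  have hNu : (0 : ℝ) < Ideal.absNorm 𝔲 := by
    exact_mod_cast Nat.pos_of_ne_zero (by rwa [Ne, Ideal.absNorm_eq_zero_iff])
  have hinj : Set.InjOn (cof 𝔲) ((G1 K 𝔴 B).filter (fun 𝔞 => 𝔲 ∣ 𝔞) : Set (Ideal (𝓞 K))) := by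
    intro 𝔞 ha 𝔞' ha' h
    rw [Finset.mem_coe, Finset.mem_filter] at ha ha'
    rw [eq_mul_cof ha.2, eq_mul_cof ha'.2, h]
  calc ∑ 𝔞 ∈ (G1 K 𝔴 B).filter (fun 𝔞 => 𝔲 ∣ 𝔞), 1 / (Ideal.absNorm 𝔞 : ℝ)
      = ∑ 𝔞 ∈ (G1 K 𝔴 B).filter (fun 𝔞 => 𝔲 ∣ 𝔞),
          1 / (Ideal.absNorm 𝔲 : ℝ) * (1 / (Ideal.absNorm (cof 𝔲 𝔞) : ℝ)) := by
        refine Finset.sum_congr rfl fun 𝔞 ha => ?_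
        rw [Finset.mem_filter] at ha
        rw [congrArg Ideal.absNorm (eq_mul_cof ha.2), map_mul, Nat.cast_mul, one_div_mul_one_div]
    _ = 1 / (Ideal.absNorm 𝔲 : ℝ) * ∑ 𝔞' ∈ ((G1 K 𝔴 B).filter (fun 𝔞 => 𝔲 ∣ 𝔞)).image (cof 𝔲),
          1 / (Ideal.absNorm 𝔞' : ℝ) := by
        rw [Finset.mul_sum, Finset.sum_image hinj]
    _ ≤ 1 / (Ideal.absNorm 𝔲 : ℝ) * ∑ 𝔞 ∈ G1 K 𝔴 B, 1 / (Ideal.absNorm 𝔞 : ℝ) := by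
        refine mul_le_mul_of_nonneg_left ?_ (by positivity)
        refine Finset.sum_le_sum_of_subset_of_nonneg (fun 𝔞' ha' => ?_) fun _ _ _ => by positivity
        rw [Finset.mem_image] at ha'
        obtain ⟨𝔞, ha, rfl⟩ := ha'
        rw [Finset.mem_filter] at ha
        exact mem_G1_of_dvd ha.1 ⟨𝔲, by rw [mul_comm]; exact eq_mul_cof ha.2⟩

/-- **The `lcm`-harmonic double sum**: `∑_{𝔞,𝔟 ∈ G1} 1/N[𝔞,𝔟] ≤ (∑_{𝔲 ∈ G1} 1/N𝔲)³`
(`1/N[𝔞,𝔟] = ∑_{𝔲 ∣ (𝔞,𝔟)} φ(𝔲)/(N𝔞N𝔟)`, swap the sums, `φ(𝔲) ≤ N𝔲`, and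
`∑_{𝔲 ∣ 𝔞} 1/N𝔞 ≤ (1/N𝔲) ∑ 1/N𝔞'`) — the `τ₃`-bound in the proof of Lemma 2.2.
[cite: CastilloEtAl2015, proof of Lemma 2.2] -/
theorem sum_G1_inv_absNorm_inf_le (𝔴 : Ideal (𝓞 K)) (B : ℝ) :
    ∑ 𝔞 ∈ G1 K 𝔴 B, ∑ 𝔟 ∈ G1 K 𝔴 B, 1 / (Ideal.absNorm (𝔞 ⊓ 𝔟) : ℝ) ≤
      (∑ 𝔲 ∈ G1 K 𝔴 B, 1 / (Ideal.absNorm 𝔲 : ℝ)) ^ 3 := by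
  set G := G1 K 𝔴 B with hG
  set H : ℝ := ∑ 𝔲 ∈ G, 1 / (Ideal.absNorm 𝔲 : ℝ) with hH
  have hH0 : 0 ≤ H := Finset.sum_nonneg fun _ _ => by positivity
  -- Step 1: `1/N[𝔞,𝔟] = ∑_{𝔲 ∣ (𝔞,𝔟)} φ(𝔲) / (N𝔞 N𝔟)`
  have hstep1 : ∀ 𝔞 ∈ G, ∀ 𝔟 ∈ G, 1 / (Ideal.absNorm (𝔞 ⊓ 𝔟) : ℝ) =
      ∑ 𝔲 ∈ G.filter (fun 𝔲 => 𝔲 ∣ 𝔞 ∧ 𝔲 ∣ 𝔟),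
        idealTotient K 𝔲 * (1 / (Ideal.absNorm 𝔞 : ℝ)) * (1 / (Ideal.absNorm 𝔟 : ℝ)) := by
    intro 𝔞 ha 𝔟 hb
    have h := inv_psi_lcm_eq (𝔴 := 𝔴) (B := B) (ψ := normR K) (ρ := idealTotient K)
      (fun 𝔞 𝔟 _ => normR_mul 𝔞 𝔟) (fun 𝔫 hn => sum_idealDivisors_idealTotient hn)
      (fun _ hn => normR_pos_of_mem_G1 hn) ha hb
    simp only [normR] at h
    rw [h, Finset.sum_div, Finset.sum_filter]
    have ha0 : 𝔞 ≠ ⊥ := (mem_G1.1 ha).1.1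
    have hJ : 𝔞 ⊔ 𝔟 ≠ ⊥ := fun h0 => ha0 (le_bot_iff.1 (h0 ▸ le_sup_left))
    -- the divisors of `𝔞 + 𝔟` are the common divisors, all in `G`
    rw [← Finset.sum_filter]
    have hset : idealDivisors K (𝔞 ⊔ 𝔟) = G.filter (fun 𝔲 => 𝔲 ∣ 𝔞 ∧ 𝔲 ∣ 𝔟) := by
      ext 𝔲
      rw [mem_idealDivisors hJ, Finset.mem_filter, ← dvd_and_dvd_iff_dvd_sup]
      constructor
      · intro h; exact ⟨mem_G1_of_dvd ha h.1, h⟩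
      · exact fun h => h.2
    rw [hset]
    refine Finset.sum_congr rfl fun 𝔲 _ => ?_
    field_simp
  -- Step 2: swap the sums
  have hstep2 : ∑ 𝔞 ∈ G, ∑ 𝔟 ∈ G, 1 / (Ideal.absNorm (𝔞 ⊓ 𝔟) : ℝ) =
      ∑ 𝔲 ∈ G, idealTotient K 𝔲 *
        (∑ 𝔞 ∈ G.filter (fun 𝔞 => 𝔲 ∣ 𝔞), 1 / (Ideal.absNorm 𝔞 : ℝ)) ^ 2 := by
    calc ∑ 𝔞 ∈ G, ∑ 𝔟 ∈ G, 1 / (Ideal.absNorm (𝔞 ⊓ 𝔟) : ℝ)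
        = ∑ 𝔞 ∈ G, ∑ 𝔟 ∈ G, ∑ 𝔲 ∈ G, (if 𝔲 ∣ 𝔞 ∧ 𝔲 ∣ 𝔟 then
            idealTotient K 𝔲 * (1 / (Ideal.absNorm 𝔞 : ℝ)) * (1 / (Ideal.absNorm 𝔟 : ℝ)) else 0) := by
          refine Finset.sum_congr rfl fun 𝔞 ha => Finset.sum_congr rfl fun 𝔟 hb => ?_
          rw [hstep1 𝔞 ha 𝔟 hb, Finset.sum_filter]
      _ = ∑ 𝔲 ∈ G, ∑ 𝔞 ∈ G, ∑ 𝔟 ∈ G, (if 𝔲 ∣ 𝔞 ∧ 𝔲 ∣ 𝔟 then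
            idealTotient K 𝔲 * (1 / (Ideal.absNorm 𝔞 : ℝ)) * (1 / (Ideal.absNorm 𝔟 : ℝ)) else 0) := by
          rw [Finset.sum_congr rfl fun 𝔞 _ => Finset.sum_comm, Finset.sum_comm]
      _ = _ := by
          refine Finset.sum_congr rfl fun 𝔲 _ => ?_
          rw [sq, Finset.sum_filter, Finset.sum_mul_sum, Finset.mul_sum]
          refine Finset.sum_congr rfl fun 𝔞 _ => ?_
          rw [Finset.mul_sum]
          refine Finset.sum_congr rfl fun 𝔟 _ => ?_
          by_cases h1 : 𝔲 ∣ 𝔞 <;> by_cases h2 : 𝔲 ∣ 𝔟 <;> simp [h1, h2]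
          ring
  rw [hstep2]
  -- Step 3: bound each term by `N𝔲 · (H/N𝔲)² = H²/N𝔲`
  calc ∑ 𝔲 ∈ G, idealTotient K 𝔲 * (∑ 𝔞 ∈ G.filter (fun 𝔞 => 𝔲 ∣ 𝔞), 1 / (Ideal.absNorm 𝔞 : ℝ)) ^ 2
      ≤ ∑ 𝔲 ∈ G, (Ideal.absNorm 𝔲 : ℝ) * (1 / (Ideal.absNorm 𝔲 : ℝ) * H) ^ 2 := by
        refine Finset.sum_le_sum fun 𝔲 hu => ?_
        have hu0 : 𝔲 ≠ ⊥ := (mem_G1.1 hu).1.1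
        have hφ0 : 0 ≤ idealTotient K 𝔲 := (idealTotient_pos hu0).le
        have hs0 : 0 ≤ ∑ 𝔞 ∈ G.filter (fun 𝔞 => 𝔲 ∣ 𝔞), 1 / (Ideal.absNorm 𝔞 : ℝ) :=
          Finset.sum_nonneg fun _ _ => by positivity
        refine mul_le_mul (idealTotient_le_absNorm 𝔲) ?_ (sq_nonneg _) (Nat.cast_nonneg _)
        exact pow_le_pow_left₀ hs0 (sum_G1_filter_dvd_le hu0) 2
    _ = H ^ 2 * ∑ 𝔲 ∈ G, 1 / (Ideal.absNorm 𝔲 : ℝ) := by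
        rw [Finset.mul_sum]
        refine Finset.sum_congr rfl fun 𝔲 hu => ?_
        have hNu : (Ideal.absNorm 𝔲 : ℝ) ≠ 0 := (normR_pos_of_mem_G1 hu).ne'
        field_simp
    _ = H ^ 3 := by rw [← hH]; ring

end Literature.NumberTheory.Sieve.MaynardNF

namespace Literature.NumberTheory.Sieve.MaynardNF

open UniqueFactorizationMonoid Literature.NumberTheory.LFunctions
  Literature.NumberTheory.LFunctions.NumberField NumberField Module

variable {K : Type*} [Field K] [NumberField K]
variable {k : ℕ}

/-! ### The error sum of Lemma 2.2 -/

/-- `N[𝔞,𝔟] ≤ N𝔞 · N𝔟` for square-free `𝔞, 𝔟` (`N[𝔞,𝔟] N(𝔞,𝔟) = N𝔞 N𝔟`). [folklore] -/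
theorem absNorm_inf_le_mul {𝔞 𝔟 : Ideal (𝓞 K)} (ha : Squarefree 𝔞) (hb : Squarefree 𝔟) :
    (Ideal.absNorm (𝔞 ⊓ 𝔟) : ℝ) ≤ Ideal.absNorm 𝔞 * Ideal.absNorm 𝔟 := by
  have h := psi_inf_mul_psi_sup (ψ := normR K) (fun 𝔞 𝔟 _ => normR_mul 𝔞 𝔟) ha hb
  simp only [normR] at h
  have ha0 : 𝔞 ≠ ⊥ := by rw [Ne, ← Ideal.zero_eq_bot]; exact ha.ne_zero
  have hsup0 : 𝔞 ⊔ 𝔟 ≠ ⊥ := fun h0 => ha0 (le_bot_iff.1 (h0 ▸ le_sup_left))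
  have hsup1 : (1 : ℝ) ≤ Ideal.absNorm (𝔞 ⊔ 𝔟) := by
    exact_mod_cast Nat.one_le_iff_ne_zero.2 (by rwa [Ne, Ideal.absNorm_eq_zero_iff])
  have hinf0 : (0 : ℝ) ≤ Ideal.absNorm (𝔞 ⊓ 𝔟) := Nat.cast_nonneg _
  nlinarith

/-- The number of good tuples of product norm `≤ R`: `#{𝔡 ∈ boxG : ∏ N𝔡ᵢ ≤ R} ≤ R (∑_{G1} 1/N𝔞)^k`.
[cite: CastilloEtAl2015, proof of Lemma 2.2] -/
theorem card_boxG_prod_le (𝔴 : Ideal (𝓞 K)) (B : ℝ) {R : ℝ} (hR : 0 ≤ R) :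
    (((boxG K k 𝔴 B).filter fun 𝔡 => ∏ i, (Ideal.absNorm (𝔡 i) : ℝ) ≤ R).card : ℝ) ≤
      R * (∑ 𝔞 ∈ G1 K 𝔴 B, 1 / (Ideal.absNorm 𝔞 : ℝ)) ^ k := by
  set S := (boxG K k 𝔴 B).filter fun 𝔡 => ∏ i, (Ideal.absNorm (𝔡 i) : ℝ) ≤ R with hS
  have hpos : ∀ 𝔡 ∈ boxG K k 𝔴 B, 0 < ∏ i, (Ideal.absNorm (𝔡 i) : ℝ) := fun 𝔡 hd =>
    Finset.prod_pos fun i _ => normR_pos_of_mem_G1 (apply_mem_G1_of_mem_boxG hd i)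
  calc ((S.card : ℕ) : ℝ) = ∑ 𝔡 ∈ S, (1 : ℝ) := by simp
    _ ≤ ∑ 𝔡 ∈ S, R * ∏ i, 1 / (Ideal.absNorm (𝔡 i) : ℝ) := by
        refine Finset.sum_le_sum fun 𝔡 hd => ?_
        rw [hS, Finset.mem_filter] at hd
        have hp := hpos 𝔡 hd.1
        rw [Finset.prod_div_distrib, Finset.prod_const_one, mul_one_div, le_div_iff₀ hp, one_mul]
        exact hd.2
    _ ≤ ∑ 𝔡 ∈ Fintype.piFinset (fun _ : Fin k => G1 K 𝔴 B), R * ∏ i, 1 / (Ideal.absNorm (𝔡 i) : ℝ) := by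
        refine Finset.sum_le_sum_of_subset_of_nonneg ?_ fun 𝔡 _ _ => ?_
        · exact (Finset.filter_subset _ _).trans (boxG_subset_piFinset k 𝔴 B)
        · exact mul_nonneg hR (Finset.prod_nonneg fun i _ => by positivity)
    _ = R * (∑ 𝔞 ∈ G1 K 𝔴 B, 1 / (Ideal.absNorm 𝔞 : ℝ)) ^ k := by
        rw [← Finset.mul_sum, ← Finset.prod_univ_sum (fun _ : Fin k => G1 K 𝔴 B)
          (fun _ 𝔞 => 1 / (Ideal.absNorm 𝔞 : ℝ)), Finset.prod_const, Finset.card_univ, Fintype.card_fin]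

/-- The double sum of `1/∏ N[𝔡ᵢ,𝔢ᵢ]` over good tuples factors over the coordinates:
`∑_{𝔡,𝔢 ∈ boxG} ∏ᵢ 1/N[𝔡ᵢ,𝔢ᵢ] ≤ (∑_{𝔞,𝔟 ∈ G1} 1/N[𝔞,𝔟])^k`. [cite: CastilloEtAl2015, proof of Lemma 2.2] -/
theorem sum_boxG_inv_prod_absNorm_inf_le (𝔴 : Ideal (𝓞 K)) (B : ℝ) :
    ∑ 𝔡 ∈ boxG K k 𝔴 B, ∑ 𝔢 ∈ boxG K k 𝔴 B, ∏ i, 1 / (Ideal.absNorm (𝔡 i ⊓ 𝔢 i) : ℝ) ≤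
      (∑ 𝔞 ∈ G1 K 𝔴 B, ∑ 𝔟 ∈ G1 K 𝔴 B, 1 / (Ideal.absNorm (𝔞 ⊓ 𝔟) : ℝ)) ^ k := by
  have hsub := boxG_subset_piFinset k 𝔴 B (K := K)
  have hnn : ∀ 𝔡 𝔢 : Fin k → Ideal (𝓞 K), 0 ≤ ∏ i, 1 / (Ideal.absNorm (𝔡 i ⊓ 𝔢 i) : ℝ) :=
    fun 𝔡 𝔢 => Finset.prod_nonneg fun i _ => by positivity
  calc ∑ 𝔡 ∈ boxG K k 𝔴 B, ∑ 𝔢 ∈ boxG K k 𝔴 B, ∏ i, 1 / (Ideal.absNorm (𝔡 i ⊓ 𝔢 i) : ℝ)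
      ≤ ∑ 𝔡 ∈ Fintype.piFinset (fun _ : Fin k => G1 K 𝔴 B),
          ∑ 𝔢 ∈ Fintype.piFinset (fun _ : Fin k => G1 K 𝔴 B), ∏ i, 1 / (Ideal.absNorm (𝔡 i ⊓ 𝔢 i) : ℝ) := by
        refine (Finset.sum_le_sum_of_subset_of_nonneg hsub fun 𝔡 _ _ =>
          Finset.sum_nonneg fun 𝔢 _ => hnn 𝔡 𝔢).trans (Finset.sum_le_sum fun 𝔡 _ => ?_)
        exact Finset.sum_le_sum_of_subset_of_nonneg hsub fun 𝔢 _ _ => hnn 𝔡 𝔢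
    _ = ∑ 𝔡 ∈ Fintype.piFinset (fun _ : Fin k => G1 K 𝔴 B),
          ∏ i, ∑ 𝔟 ∈ G1 K 𝔴 B, 1 / (Ideal.absNorm (𝔡 i ⊓ 𝔟) : ℝ) := by
        refine Finset.sum_congr rfl fun 𝔡 _ => ?_
        rw [Finset.prod_univ_sum]
    _ = ∏ _i : Fin k, ∑ 𝔞 ∈ G1 K 𝔴 B, ∑ 𝔟 ∈ G1 K 𝔴 B, 1 / (Ideal.absNorm (𝔞 ⊓ 𝔟) : ℝ) := by
        rw [Finset.prod_univ_sum]
    _ = _ := by rw [Finset.prod_const, Finset.card_univ, Fintype.card_fin]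

/-- **The error sum of Lemma 2.2** (Castillo et al.: "`≪ λ_max² |A(N)|^{1−ν} R^{2ν}(log R)^{3k}`,
negligible because `R = |A(N)|^{1/2−δ}`): if `λ` is supported on good tuples of product norm `≤ R`
(`R ≥ 1`) and `|λ| ≤ λ_max`, then with `H₁ = ∑_{G1} 1/N𝔞`, `H₂ = ∑_{𝔞,𝔟∈G1} 1/N[𝔞,𝔟]`,
`∑_{𝔡,𝔢 good} |λ_𝔡λ_𝔢| (1 + (N^d/(N𝔴 ∏N[𝔡ᵢ,𝔢ᵢ]))^{1−1/d})
  ≤ λ_max² (R² H₁^{2k} + (N^d/N𝔴)^{1−1/d} (R²)^{1/d} H₂^k)`. [cite: CastilloEtAl2015, proof of Lemma 2.2] -/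
theorem sum_lam_error_le {𝔴 : Ideal (𝓞 K)} (h𝔴 : 𝔴 ≠ ⊥) {B R : ℝ} (hR : 1 ≤ R)
    {Λ : (Fin k → Ideal (𝓞 K)) → ℝ}
    (hsupp : ∀ 𝔡, Λ 𝔡 ≠ 0 → 𝔡 ∈ boxG K k 𝔴 B ∧ ∏ i, (Ideal.absNorm (𝔡 i) : ℝ) ≤ R)
    {lmax : ℝ} (hl : ∀ 𝔡, |Λ 𝔡| ≤ lmax) {N : ℝ} (hN : 0 ≤ N) :
    ∑ 𝔡 ∈ boxG K k 𝔴 B, ∑ 𝔢 ∈ boxG K k 𝔴 B,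
        |Λ 𝔡| * |Λ 𝔢| *
          (1 + (N ^ finrank ℚ K / (Ideal.absNorm 𝔴 * ∏ i, (Ideal.absNorm (𝔡 i ⊓ 𝔢 i) : ℝ))) ^
            (1 - 1 / (finrank ℚ K : ℝ))) ≤
      lmax ^ 2 * (R ^ 2 * (∑ 𝔞 ∈ G1 K 𝔴 B, 1 / (Ideal.absNorm 𝔞 : ℝ)) ^ (2 * k) +
        (N ^ finrank ℚ K / Ideal.absNorm 𝔴) ^ (1 - 1 / (finrank ℚ K : ℝ)) * (R ^ 2) ^ (1 / (finrank ℚ K : ℝ)) *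
          (∑ 𝔞 ∈ G1 K 𝔴 B, ∑ 𝔟 ∈ G1 K 𝔴 B, 1 / (Ideal.absNorm (𝔞 ⊓ 𝔟) : ℝ)) ^ k) := by
  have hR0 : 0 ≤ R := by linarith
  have hcard := card_boxG_prod_le (k := k) 𝔴 B hR0 (K := K)
  have hH2k := sum_boxG_inv_prod_absNorm_inf_le (k := k) 𝔴 B (K := K)
  set d := finrank ℚ K with hdK
  set e : ℝ := 1 - 1 / (d : ℝ) with he_def
  set c : ℝ := N ^ d / Ideal.absNorm 𝔴 with hc
  set S := (boxG K k 𝔴 B).filter fun 𝔡 => ∏ i, (Ideal.absNorm (𝔡 i) : ℝ) ≤ R with hS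
  set H₁ : ℝ := ∑ 𝔞 ∈ G1 K 𝔴 B, 1 / (Ideal.absNorm 𝔞 : ℝ) with hH₁
  set H₂ : ℝ := ∑ 𝔞 ∈ G1 K 𝔴 B, ∑ 𝔟 ∈ G1 K 𝔴 B, 1 / (Ideal.absNorm (𝔞 ⊓ 𝔟) : ℝ) with hH₂
  have hd1 : (1 : ℝ) ≤ d := by exact_mod_cast (finrank_pos : 0 < d)
  have hd0 : (0 : ℝ) < d := by linarith
  have he0 : 0 ≤ e := by rw [he_def, sub_nonneg, div_le_one hd0]; exact hd1
  have hinvd : 0 ≤ 1 / (d : ℝ) := by positivity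
  have hN𝔴 : (1 : ℝ) ≤ Ideal.absNorm 𝔴 := by
    exact_mod_cast Nat.one_le_iff_ne_zero.2 (by rwa [Ne, Ideal.absNorm_eq_zero_iff])
  have hc0 : 0 ≤ c := div_nonneg (pow_nonneg hN d) (by linarith)
  have hl0 : 0 ≤ lmax := (abs_nonneg _).trans (hl fun _ => ⊤)
  -- restrict to `S × S`
  have hzero : ∀ 𝔡, 𝔡 ∉ S → Λ 𝔡 = 0 := by
    intro 𝔡 hd
    by_contra h
    exact hd (Finset.mem_filter.2 (hsupp 𝔡 h))
  have hSsub : S ⊆ boxG K k 𝔴 B := Finset.filter_subset _ _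
  have hx1 : ∀ 𝔡 ∈ boxG K k 𝔴 B, ∀ 𝔢 ∈ boxG K k 𝔴 B, (1 : ℝ) ≤ ∏ i, (Ideal.absNorm (𝔡 i ⊓ 𝔢 i) : ℝ) := by
    intro 𝔡 hd 𝔢 he
    rw [← Finset.prod_const_one (s := (Finset.univ : Finset (Fin k)))]
    refine Finset.prod_le_prod (fun _ _ => zero_le_one) fun i _ => ?_
    have hdG := (mem_boxG.1 hd).2
    have heG := (mem_boxG.1 he).2
    have h0 : 𝔡 i ⊓ 𝔢 i ≠ ⊥ := by
      intro h0
      have hdi : 𝔡 i * 𝔢 i ≤ ⊥ := Ideal.mul_le_inf.trans (le_of_eq h0)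
      rw [le_bot_iff, ← Ideal.zero_eq_bot, mul_eq_zero] at hdi
      rcases hdi with h | h
      · exact hdG.ne_bot i (by rwa [Ideal.zero_eq_bot] at h)
      · exact heG.ne_bot i (by rwa [Ideal.zero_eq_bot] at h)
    exact_mod_cast Nat.one_le_iff_ne_zero.2 (by rwa [Ne, Ideal.absNorm_eq_zero_iff])
  -- the weight `t(𝔡,𝔢) = (c/x)^e` and its bound on `S × S`
  have ht : ∀ 𝔡 ∈ S, ∀ 𝔢 ∈ S,
      (c / ∏ i, (Ideal.absNorm (𝔡 i ⊓ 𝔢 i) : ℝ)) ^ e ≤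
        c ^ e * (R ^ 2) ^ (1 / (d : ℝ)) * ∏ i, 1 / (Ideal.absNorm (𝔡 i ⊓ 𝔢 i) : ℝ) := by
    intro 𝔡 hd 𝔢 he
    rw [hS, Finset.mem_filter] at hd he
    set x : ℝ := ∏ i, (Ideal.absNorm (𝔡 i ⊓ 𝔢 i) : ℝ) with hx
    have hx1' := hx1 𝔡 hd.1 𝔢 he.1
    have hxpos : 0 < x := by rw [hx]; linarith
    have hxR : x ≤ R ^ 2 := by
      calc x ≤ ∏ i, ((Ideal.absNorm (𝔡 i) : ℝ) * Ideal.absNorm (𝔢 i)) := by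
            refine Finset.prod_le_prod (fun i _ => Nat.cast_nonneg _) fun i _ => ?_
            exact absNorm_inf_le_mul ((mem_boxG.1 hd.1).2.squarefree_apply i)
              ((mem_boxG.1 he.1).2.squarefree_apply i)
        _ = (∏ i, (Ideal.absNorm (𝔡 i) : ℝ)) * ∏ i, (Ideal.absNorm (𝔢 i) : ℝ) := Finset.prod_mul_distrib
        _ ≤ R * R := mul_le_mul hd.2 he.2 (Finset.prod_nonneg fun i _ => Nat.cast_nonneg _) hR0
        _ = R ^ 2 := (sq R).symm
    rw [Real.div_rpow hc0 hxpos.le, div_eq_mul_inv, ← Real.rpow_neg hxpos.le]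
    have hprod : ∏ i, 1 / (Ideal.absNorm (𝔡 i ⊓ 𝔢 i) : ℝ) = x⁻¹ := by
      rw [Finset.prod_div_distrib, Finset.prod_const_one, one_div]
    rw [hprod, mul_assoc]
    refine mul_le_mul_of_nonneg_left ?_ (Real.rpow_nonneg hc0 e)
    -- `x^{-e} = x^{1/d} x^{-1} ≤ (R²)^{1/d} x^{-1}`
    have : x ^ (-e) = x ^ (1 / (d : ℝ)) * x⁻¹ := by
      rw [he_def, show -(1 - 1 / (d : ℝ)) = 1 / (d : ℝ) + (-1) by ring, Real.rpow_add hxpos,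
        Real.rpow_neg_one]
    rw [this]
    exact mul_le_mul_of_nonneg_right (Real.rpow_le_rpow hxpos.le hxR hinvd) (inv_nonneg.2 hxpos.le)
  -- main computation
  calc ∑ 𝔡 ∈ boxG K k 𝔴 B, ∑ 𝔢 ∈ boxG K k 𝔴 B,
        |Λ 𝔡| * |Λ 𝔢| * (1 + (N ^ d / (Ideal.absNorm 𝔴 * ∏ i, (Ideal.absNorm (𝔡 i ⊓ 𝔢 i) : ℝ))) ^ e)
      = ∑ 𝔡 ∈ S, ∑ 𝔢 ∈ S,
        |Λ 𝔡| * |Λ 𝔢| * (1 + (c / ∏ i, (Ideal.absNorm (𝔡 i ⊓ 𝔢 i) : ℝ)) ^ e) := by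
        symm
        rw [Finset.sum_subset hSsub fun 𝔡 _ hd => ?_]
        · refine Finset.sum_congr rfl fun 𝔡 _ => ?_
          rw [Finset.sum_subset hSsub fun 𝔢 _ he => ?_]
          · refine Finset.sum_congr rfl fun 𝔢 _ => ?_
            rw [hc, div_div]
          · rw [hzero 𝔢 he, abs_zero, mul_zero, zero_mul]
        · exact Finset.sum_eq_zero fun 𝔢 _ => by rw [hzero 𝔡 hd, abs_zero, zero_mul, zero_mul]
    _ ≤ ∑ 𝔡 ∈ S, ∑ 𝔢 ∈ S, lmax ^ 2 *
        (1 + c ^ e * (R ^ 2) ^ (1 / (d : ℝ)) * ∏ i, 1 / (Ideal.absNorm (𝔡 i ⊓ 𝔢 i) : ℝ)) := by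
        refine Finset.sum_le_sum fun 𝔡 hd => Finset.sum_le_sum fun 𝔢 he => ?_
        have h1 : |Λ 𝔡| * |Λ 𝔢| ≤ lmax ^ 2 := by
          rw [sq]; exact mul_le_mul (hl 𝔡) (hl 𝔢) (abs_nonneg _) hl0
        have hfac0 : 0 ≤ 1 + (c / ∏ i, (Ideal.absNorm (𝔡 i ⊓ 𝔢 i) : ℝ)) ^ e := by
          have : 0 ≤ (c / ∏ i, (Ideal.absNorm (𝔡 i ⊓ 𝔢 i) : ℝ)) ^ e :=
            Real.rpow_nonneg (div_nonneg hc0 (by linarith [hx1 𝔡 (hSsub hd) 𝔢 (hSsub he)])) e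
          linarith
        calc |Λ 𝔡| * |Λ 𝔢| * (1 + (c / ∏ i, (Ideal.absNorm (𝔡 i ⊓ 𝔢 i) : ℝ)) ^ e)
            ≤ lmax ^ 2 * (1 + (c / ∏ i, (Ideal.absNorm (𝔡 i ⊓ 𝔢 i) : ℝ)) ^ e) :=
              mul_le_mul_of_nonneg_right h1 hfac0
          _ ≤ _ := mul_le_mul_of_nonneg_left (by linarith [ht 𝔡 hd 𝔢 he]) (sq_nonneg _)
    _ = lmax ^ 2 * ((S.card : ℝ) * S.card +
        c ^ e * (R ^ 2) ^ (1 / (d : ℝ)) * ∑ 𝔡 ∈ S, ∑ 𝔢 ∈ S, ∏ i, 1 / (Ideal.absNorm (𝔡 i ⊓ 𝔢 i) : ℝ)) := by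
        simp_rw [← Finset.mul_sum]
        congr 1
        rw [Finset.sum_congr rfl fun 𝔡 _ => by
          rw [Finset.sum_add_distrib, Finset.sum_const, nsmul_eq_mul, mul_one, ← Finset.mul_sum],
          Finset.sum_add_distrib, Finset.sum_const, nsmul_eq_mul, ← Finset.mul_sum]
    _ ≤ lmax ^ 2 * (R ^ 2 * H₁ ^ (2 * k) + c ^ e * (R ^ 2) ^ (1 / (d : ℝ)) * H₂ ^ k) := by
        refine mul_le_mul_of_nonneg_left (add_le_add ?_ ?_) (sq_nonneg _)
        · have hH0 : 0 ≤ H₁ := Finset.sum_nonneg fun _ _ => by positivity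
          calc (S.card : ℝ) * S.card ≤ (R * H₁ ^ k) * (R * H₁ ^ k) :=
                mul_le_mul hcard hcard (Nat.cast_nonneg _) (mul_nonneg hR0 (pow_nonneg hH0 k))
            _ = R ^ 2 * H₁ ^ (2 * k) := by ring
        · refine mul_le_mul_of_nonneg_left ?_
            (mul_nonneg (Real.rpow_nonneg hc0 e) (Real.rpow_nonneg (sq_nonneg R) _))
          have hnn : ∀ 𝔡 𝔢 : Fin k → Ideal (𝓞 K), 0 ≤ ∏ i, 1 / (Ideal.absNorm (𝔡 i ⊓ 𝔢 i) : ℝ) :=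
            fun 𝔡 𝔢 => Finset.prod_nonneg fun i _ => by positivity
          calc ∑ 𝔡 ∈ S, ∑ 𝔢 ∈ S, ∏ i, 1 / (Ideal.absNorm (𝔡 i ⊓ 𝔢 i) : ℝ)
              ≤ ∑ 𝔡 ∈ boxG K k 𝔴 B, ∑ 𝔢 ∈ boxG K k 𝔴 B, ∏ i, 1 / (Ideal.absNorm (𝔡 i ⊓ 𝔢 i) : ℝ) := by
                refine (Finset.sum_le_sum_of_subset_of_nonneg hSsub fun 𝔡 _ _ =>
                  Finset.sum_nonneg fun 𝔢 _ => hnn 𝔡 𝔢).trans (Finset.sum_le_sum fun 𝔡 _ => ?_)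
                exact Finset.sum_le_sum_of_subset_of_nonneg hSsub fun 𝔢 _ _ => hnn 𝔡 𝔢
            _ ≤ H₂ ^ k := hH2k

end Literature.NumberTheory.Sieve.MaynardNF

namespace Literature.NumberTheory.Sieve.MaynardNF

open UniqueFactorizationMonoid Literature.NumberTheory.LFunctions
  Literature.NumberTheory.LFunctions.NumberField NumberField Module

variable {K : Type*} [Field K] [NumberField K]
variable {k : ℕ}

/-! ### Lemma 2.2 in combinatorial form -/

/-- If `λ_𝔡 ≠ 0` then `𝔡` is a good tuple of the box dividing some `𝔯` of the support of `y`; in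
particular `∏ N𝔡ᵢ ≤ R` when `y` lives on tuples of product norm `≤ R`. [folklore] -/
theorem prod_le_of_lam_ne_zero {𝔴 : Ideal (𝓞 K)} {B R : ℝ} {y : (Fin k → Ideal (𝓞 K)) → ℝ}
    (hy : SupportedOn K k 𝔴 B y) (hyR : ∀ 𝔯, y 𝔯 ≠ 0 → ∏ i, (Ideal.absNorm (𝔯 i) : ℝ) ≤ R)
    {𝔡 : Fin k → Ideal (𝓞 K)} (hd : lam K k B y 𝔡 ≠ 0) :
    𝔡 ∈ boxG K k 𝔴 B ∧ ∏ i, (Ideal.absNorm (𝔡 i) : ℝ) ≤ R := by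
  have hdG : 𝔡 ∈ boxG K k 𝔴 B := by
    by_contra h
    exact hd (lam_eq_zero_of_not hy h)
  refine ⟨hdG, ?_⟩
  rw [lam_def] at hd
  have hsum := right_ne_zero_of_mul hd
  obtain ⟨𝔯, hr, hne⟩ := Finset.exists_ne_zero_of_sum_ne_zero hsum
  rw [Finset.mem_filter] at hr
  have hy0 : y 𝔯 ≠ 0 := by
    intro h0; rw [h0, zero_div] at hne; exact hne rfl
  refine le_trans (Finset.prod_le_prod (fun i _ => Nat.cast_nonneg _) fun i _ => ?_) (hyR 𝔯 hy0)
  have hri : 𝔯 i ≠ ⊥ := (mem_box_iff.1 hr.1 i).1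
  have hN : Ideal.absNorm (𝔯 i) ≠ 0 := by rwa [Ne, Ideal.absNorm_eq_zero_iff]
  exact_mod_cast Nat.le_of_dvd (Nat.pos_of_ne_zero hN) (map_dvd _ (hr.2 i))

/-- **Lemma 2.2 of Castillo et al. in combinatorial form** (Maynard's Lemma 5.1 over `𝓞_K`, before
the asymptotic evaluation of the constants): for totally real `K` (through `UniformCount K C`),
`𝔴 ≠ 0`, `B, R, N ≥ 1`, `y` supported on good tuples of the box of product norm `≤ R` with
`|y| ≤ y_max`, and shifts `h` such that every prime ideal containing some `hᵢ − hⱼ` (`i ≠ j`)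
divides `𝔴`: with `X = (2^d − 1)N^d/(N𝔴 √|D_K|)` (`= |A(N)|/|𝔴|` to first order),
`L = ∑_{G1} 1/φ`, `Z = ∑_{G1} 1/φ²`, `H₁ = ∑_{G1} 1/N`, `H₂ = ∑_{G1×G1} 1/N[·,·]`, `K' = k² − k`,

  `|S₁ − X ∑_𝔲 y_𝔲²/∏φ(𝔲ᵢ)| ≤ X y_max² L^k (Z^{K'} − 1)
      + |C| (y_max L^{2k})² (R² H₁^{2k} + (N^d/N𝔴)^{1−1/d} (R²)^{1/d} H₂^k)`.

[cite: CastilloEtAl2015, Lemma 2.2] -/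
theorem abs_S1_sub_main_le {C : ℝ} (hC : UniformCount K C) {𝔴 : Ideal (𝓞 K)} (h𝔴 : 𝔴 ≠ ⊥)
    {B : ℝ} (hB : 1 ≤ B) {R : ℝ} (hR : 1 ≤ R) {y : (Fin k → Ideal (𝓞 K)) → ℝ}
    (hy : SupportedOn K k 𝔴 B y) {ymax : ℝ} (hymax : ∀ 𝔯, |y 𝔯| ≤ ymax)
    (hyR : ∀ 𝔯, y 𝔯 ≠ 0 → ∏ i, (Ideal.absNorm (𝔯 i) : ℝ) ≤ R) {h : Fin k → 𝓞 K}
    (hh : ∀ i j, i ≠ j → ∀ P : Ideal (𝓞 K), P.IsPrime → h i - h j ∈ P → P ∣ 𝔴) (ν₀ : 𝓞 K)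
    {N : ℝ} (hN : 1 ≤ N) :
    |S1 K k 𝔴 B y h ν₀ N -
        (2 ^ finrank ℚ K - 1) * N ^ finrank ℚ K / (Ideal.absNorm 𝔴 * √|discr K|) *
          ∑ 𝔲 ∈ boxG K k 𝔴 B, y 𝔲 ^ 2 / ∏ i, idealTotient K (𝔲 i)| ≤
      (2 ^ finrank ℚ K - 1) * N ^ finrank ℚ K / (Ideal.absNorm 𝔴 * √|discr K|) *
          (ymax ^ 2 * (∑ 𝔫 ∈ G1 K 𝔴 B, 1 / idealTotient K 𝔫) ^ k *
            ((∑ 𝔫 ∈ G1 K 𝔴 B, 1 / idealTotient K 𝔫 ^ 2) ^ Fintype.card (OffDiag k) - 1)) +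
        |C| * ((ymax * (∑ 𝔢 ∈ G1 K 𝔴 B, 1 / idealTotient K 𝔢) ^ (2 * k)) ^ 2 *
          (R ^ 2 * (∑ 𝔞 ∈ G1 K 𝔴 B, 1 / (Ideal.absNorm 𝔞 : ℝ)) ^ (2 * k) +
            (N ^ finrank ℚ K / Ideal.absNorm 𝔴) ^ (1 - 1 / (finrank ℚ K : ℝ)) *
              (R ^ 2) ^ (1 / (finrank ℚ K : ℝ)) *
              (∑ 𝔞 ∈ G1 K 𝔴 B, ∑ 𝔟 ∈ G1 K 𝔴 B, 1 / (Ideal.absNorm (𝔞 ⊓ 𝔟) : ℝ)) ^ k)) := by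
  have hN0 : 0 ≤ N := by linarith
  have h51 := abs_S1_sub_bilinear_le hC h𝔴 hy hh ν₀ hN
  have hmain := abs_S1main_sub_le hB hy hymax (k := k)
  have hlam := fun 𝔡 => abs_lam_le hy hymax 𝔡 (k := k)
  have herr := sum_lam_error_le (k := k) h𝔴 hR (Λ := lam K k B y)
    (fun 𝔡 hd => prod_le_of_lam_ne_zero hy hyR hd) hlam hN0
  set X : ℝ := (2 ^ finrank ℚ K - 1) * N ^ finrank ℚ K / (Ideal.absNorm 𝔴 * √|discr K|) with hX
  have hX0 : 0 ≤ X := by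
    rw [hX]
    refine div_nonneg (mul_nonneg ?_ (pow_nonneg hN0 _)) (mul_nonneg (Nat.cast_nonneg _) (Real.sqrt_nonneg _))
    have : (1 : ℝ) ≤ 2 ^ finrank ℚ K := one_le_pow₀ (by norm_num)
    linarith
  set Sp := ∑ 𝔡 ∈ boxG K k 𝔴 B, ∑ 𝔢 ∈ boxG K k 𝔴 B,
    (if ∀ p : OffDiag k, 𝔡 p.1.1 ⊔ 𝔢 p.1.2 = ⊤ then
      lam K k B y 𝔡 * lam K k B y 𝔢 / ∏ i, (Ideal.absNorm (𝔡 i ⊓ 𝔢 i) : ℝ) else 0) with hSp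
  set M := ∑ 𝔲 ∈ boxG K k 𝔴 B, y 𝔲 ^ 2 / ∏ i, idealTotient K (𝔲 i) with hM
  have hsplit : S1 K k 𝔴 B y h ν₀ N - X * M = X * (Sp - M) + (S1 K k 𝔴 B y h ν₀ N - X * Sp) := by ring
  rw [hsplit]
  refine (abs_add_le _ _).trans (add_le_add ?_ ?_)
  · rw [abs_mul, abs_of_nonneg hX0]
    exact mul_le_mul_of_nonneg_left hmain hX0
  · exact h51.trans (mul_le_mul_of_nonneg_left herr (abs_nonneg C))

end Literature.NumberTheory.Sieve.MaynardNF

namespace Literature.NumberTheory.Sieve.MaynardNF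

open UniqueFactorizationMonoid Literature.NumberTheory.LFunctions
  Literature.NumberTheory.LFunctions.NumberField NumberField

variable {K : Type*} [Field K] [NumberField K]

/-! ### Bridges from the `G1`-sums `L, Z, L_g, Z_g` to the one-dimensional sieve sums of `IdealSieveSums` -/

/-- `G1 K 𝔴 B` is the index set of `IdealSieveSums` (filters commute). [folklore] -/
theorem G1_eq_filter (𝔴 : Ideal (𝓞 K)) (B : ℝ) :
    G1 K 𝔴 B = (idealsLE K B).filter (fun 𝔲 => 𝔲 ⊔ 𝔴 = ⊤ ∧ Squarefree 𝔲) := by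
  ext 𝔲; simp only [G1, Finset.mem_filter]; tauto

/-- On `G1`, `1/φ(𝔲) = ∏_{P∣𝔲} 1/(NP − 1)`. [folklore] -/
theorem inv_idealTotient_eq_prod {𝔴 : Ideal (𝓞 K)} {B : ℝ} {𝔲 : Ideal (𝓞 K)} (hu : 𝔲 ∈ G1 K 𝔴 B) :
    1 / idealTotient K 𝔲 = ∏ P ∈ (normalizedFactors 𝔲).toFinset, 1 / ((Ideal.absNorm P : ℝ) - 1) := by
  rw [idealTotient_of_squarefree (mem_G1.1 hu).2.1, one_div, ← Finset.prod_inv_distrib]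
  exact Finset.prod_congr rfl fun P _ => (one_div _).symm

/-- On `G1`, `1/g(𝔲) = ∏_{P∣𝔲} 1/(NP − 2)`. [folklore] -/
theorem inv_gId_eq_prod (𝔲 : Ideal (𝓞 K)) :
    1 / gId K 𝔲 = ∏ P ∈ (normalizedFactors 𝔲).toFinset, 1 / ((Ideal.absNorm P : ℝ) - 2) := by
  rw [gId, one_div, ← Finset.prod_inv_distrib]
  exact Finset.prod_congr rfl fun P _ => (one_div _).symm

/-- `L = ∑_{G1} 1/φ` is the sum of `IdealSieve.abs_sum_inv_totientIdeal_sub_le`. [folklore] -/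
theorem sum_G1_inv_idealTotient_eq (𝔴 : Ideal (𝓞 K)) (B : ℝ) :
    ∑ 𝔲 ∈ G1 K 𝔴 B, 1 / idealTotient K 𝔲 =
      ∑ 𝔲 ∈ (idealsLE K B).filter (fun 𝔲 => 𝔲 ⊔ 𝔴 = ⊤ ∧ Squarefree 𝔲),
        ∏ P ∈ (normalizedFactors 𝔲).toFinset, 1 / ((Ideal.absNorm P : ℝ) - 1) := by
  rw [← G1_eq_filter]
  exact Finset.sum_congr rfl fun 𝔲 hu => inv_idealTotient_eq_prod hu

/-- `L_g = ∑_{G1} 1/g` is the sum of `IdealSieve.abs_sum_inv_gIdeal_sub_le`. [folklore] -/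
theorem sum_G1_inv_gId_eq (𝔴 : Ideal (𝓞 K)) (B : ℝ) :
    ∑ 𝔲 ∈ G1 K 𝔴 B, 1 / gId K 𝔲 =
      ∑ 𝔲 ∈ (idealsLE K B).filter (fun 𝔲 => 𝔲 ⊔ 𝔴 = ⊤ ∧ Squarefree 𝔲),
        ∏ P ∈ (normalizedFactors 𝔲).toFinset, 1 / ((Ideal.absNorm P : ℝ) - 2) := by
  rw [← G1_eq_filter]
  exact Finset.sum_congr rfl fun 𝔲 _ => inv_gId_eq_prod 𝔲

/-- `Z − 1 = ∑_{G1, 𝔲 ≠ (1)} 1/φ(𝔲)²` is the tail of `IdealSieve.sum_inv_prod_sub_sq_le` with `k = 1`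
(`B ≥ 1`). [folklore] -/
theorem sum_G1_inv_idealTotient_sq_sub_one_eq (𝔴 : Ideal (𝓞 K)) {B : ℝ} (hB : 1 ≤ B) :
    ∑ 𝔲 ∈ G1 K 𝔴 B, 1 / idealTotient K 𝔲 ^ 2 - 1 =
      ∑ 𝔲 ∈ (idealsLE K B).filter (fun 𝔲 => 𝔲 ⊔ 𝔴 = ⊤ ∧ Squarefree 𝔲 ∧ 𝔲 ≠ ⊤),
        ∏ P ∈ (normalizedFactors 𝔲).toFinset, 1 / ((Ideal.absNorm P : ℝ) - (1 : ℕ)) ^ 2 := by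
  have htop : (⊤ : Ideal (𝓞 K)) ∈ G1 K 𝔴 B := top_mem_G1 hB
  rw [← Finset.add_sum_erase _ _ htop, idealTotient_top]
  simp only [one_pow, div_one, add_sub_cancel_left, Nat.cast_one]
  have hset : (G1 K 𝔴 B).erase ⊤ =
      (idealsLE K B).filter (fun 𝔲 => 𝔲 ⊔ 𝔴 = ⊤ ∧ Squarefree 𝔲 ∧ 𝔲 ≠ ⊤) := by
    ext 𝔲
    simp only [Finset.mem_erase, G1, Finset.mem_filter]
    tauto
  rw [hset]
  refine Finset.sum_congr rfl fun 𝔲 hu => ?_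
  have hu' : 𝔲 ∈ G1 K 𝔴 B := by
    rw [Finset.mem_filter] at hu
    exact Finset.mem_filter.2 ⟨hu.1, hu.2.2.1, hu.2.1⟩
  rw [← one_div_pow, inv_idealTotient_eq_prod hu', ← Finset.prod_pow]
  exact Finset.prod_congr rfl fun P _ => by rw [one_div_pow]

/-- `Z_g − 1 = ∑_{G1, 𝔲 ≠ (1)} 1/g(𝔲)²`, the tail with `k = 2` (`B ≥ 1`). [folklore] -/
theorem sum_G1_inv_gId_sq_sub_one_eq (𝔴 : Ideal (𝓞 K)) {B : ℝ} (hB : 1 ≤ B) :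
    ∑ 𝔲 ∈ G1 K 𝔴 B, 1 / gId K 𝔲 ^ 2 - 1 =
      ∑ 𝔲 ∈ (idealsLE K B).filter (fun 𝔲 => 𝔲 ⊔ 𝔴 = ⊤ ∧ Squarefree 𝔲 ∧ 𝔲 ≠ ⊤),
        ∏ P ∈ (normalizedFactors 𝔲).toFinset, 1 / ((Ideal.absNorm P : ℝ) - (2 : ℕ)) ^ 2 := by
  have htop : (⊤ : Ideal (𝓞 K)) ∈ G1 K 𝔴 B := top_mem_G1 hB
  rw [← Finset.add_sum_erase _ _ htop, gId_top]
  simp only [one_pow, div_one, add_sub_cancel_left, Nat.cast_ofNat]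
  have hset : (G1 K 𝔴 B).erase ⊤ =
      (idealsLE K B).filter (fun 𝔲 => 𝔲 ⊔ 𝔴 = ⊤ ∧ Squarefree 𝔲 ∧ 𝔲 ≠ ⊤) := by
    ext 𝔲
    simp only [Finset.mem_erase, G1, Finset.mem_filter]
    tauto
  rw [hset]
  refine Finset.sum_congr rfl fun 𝔲 _ => ?_
  rw [← one_div_pow, inv_gId_eq_prod 𝔲, ← Finset.prod_pow]
  exact Finset.prod_congr rfl fun P _ => by rw [one_div_pow]

end Literature.NumberTheory.Sieve.MaynardNF
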